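import Literature.AlgebraicTopology.SingularHomology.CechSingularBridge
import HarnessLib

/-!
# Contractible subsets are acyclic for concrete cochains with arbitrary coefficients

Topic `AlgebraicTopology/SingularHomology`; namespace
`Literature.AlgebraicTopology.SingularHomology`.  Theorems only (no definition, no named fact, no
instance, no `sorry`).

`Literature/AlgebraicTopology/SingularHomology/SubsetCohomologyContractible` proves
`H^p_X(W; ULift R) = 0` (`p > 0`) for a contractible subset `W`, with coefficients the ring `R`
itself, and `CechSingularBridge` records the consequence `exists_cod_eq_of_contractibleSpace`
(the acyclicity hypothesis of the Čech–singular comparison `cechSingularEquiv`).  The three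
isomorphisms used there — `subspaceIso` (chains of `↥W` = chains of `X` in `W`),
`csingularChainComplex.compIso` (concrete chains = Mathlib's chains) and
`singularCochainComplex.cochainIso R M` (cochains = dual of chains, ANY coefficient module `M`) —
are coefficient-agnostic, so the same argument gives the statements for coefficients
`ULift M`, `M` an arbitrary `R`-module (A. Hatcher, *Algebraic Topology* (2002), §3.1 p. 197 and
p. 201: cohomology with coefficients in `G` of a contractible space is that of a point):

* `subsetCochains.isZero_homology_of_contractibleSpace'` — `H^p_X(W; ULift M) = 0` for `p > 0`;
* `exists_cod_eq_of_contractibleSpace'` — every concrete `(q+1)`-cocycle of `W` with values in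
  `ULift M` is a coboundary.

## References

* A. Hatcher, *Algebraic Topology*, CUP 2002, §3.1 pp. 197–201. [HatcherAT2002]
-/

noncomputable section

open CategoryTheory Limits

universe u v

namespace Literature.AlgebraicTopology.SingularHomology

variable (R : Type v) [CommRing R] {M : Type v} [AddCommGroup M] [Module R M]
  {X : Type u} [TopologicalSpace X]

/-- **`H^p_X(W; ULift M) = 0` for `p > 0` and `↥W` contractible**, for an arbitrary coefficient
module `M` (Hatcher 2002, §3.1 p. 201: `Hⁿ(X; G) ≅ Hⁿ(pt; G) = 0`). [cite: HatcherAT2002, §3.1 p. 201] -/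
theorem subsetCochains.isZero_homology_of_contractibleSpace' (W : Set X) [ContractibleSpace ↥W]
    {p : ℕ} (hp : p ≠ 0) :
    IsZero ((subsetCochains R (ModuleCat.of R (ULift.{u} M)) W).homology p) := by
  have e : subsetCochains R (ModuleCat.of R (ULift.{u} M)) W ≅ singularCochainComplex R M (↥W) :=
    dualMapIso (N := ModuleCat.of R (ULift.{u} M)) (subspaceIso R R X W) ≪≫
      (dualMapIso (N := ModuleCat.of R (ULift.{u} M)) (csingularChainComplex.compIso R R (↥W))).symm ≪≫
        (singularCochainComplex.cochainIso R M (↥W)).symm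
  exact IsZero.of_iso (singularCochainComplex.isZero_singularCohomology_of_subsingleton' hp)
    ((HomologicalComplex.homologyFunctor _ _ p).mapIso e ≪≫
      (singularCohomology.isoOfContractible R M (↥W) p).symm)

/-- **Contractible subsets are acyclic for the concrete cochains with coefficients `ULift M`**:
every concrete `(q+1)`-cocycle of `W` is a coboundary (the hypothesis `hacyc` of
`cechSingular_colExact` / `cechSingularEquiv` for a good cover, arbitrary coefficients).
[cite: HatcherAT2002, §3.1 p. 201] -/
theorem exists_cod_eq_of_contractibleSpace' (W : Set X) [ContractibleSpace ↥W] {q : ℕ}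
    (ψ : CochainOn R (ULift.{u} M) W (q + 1)) (hψ : cod W (q + 1) ψ = 0) :
    ∃ φ : CochainOn R (ULift.{u} M) W q, cod W q φ = ψ :=
  exists_cod_eq_of_isZero_homology W
    (subsetCochains.isZero_homology_of_contractibleSpace' R W (Nat.succ_ne_zero q)) ψ hψ

end Literature.AlgebraicTopology.SingularHomology
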